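import Summits.QuantumFields.BalabanUV.Beta.SpineRecursiveW

/-!
# `BalabanUV.Beta.SecondOrderLocks` — binder row D1, (L4): **THE UNITS LOCKS OF THE SECOND-ORDER LETTER LAW ARE LEVEL-INDEPENDENT PINS** —
# (W-L-B) the border letter's lock ⟺ `cB = −cVH²/Lc⁴`, (W-L-Λ) the mixed letter's lock ⟺ `cΛ·cVH = −Lc⁴`, displayed beside (W-L-1) `cE = Lc⁴` and
# (W-L-2) `cE₂ = Lc⁸` (β sub-cell, row BETA-an2 = BINDER-OWNERS row D1 OWNER, lineage an2 gen 18; journal l.11557 / l.11963, memo `SKELETON-D1-L4` v2.1 §2)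

HONEST FRAMING (cell charter, verbatim): «discharging BetaPertH makes Balaban's UV stability UNCONDITIONAL — a real
constructive-QFT result; it is NOT the continuum limit and NOT the Clay problem.»  UNITS BOOKKEEPING ([folklore] real arithmetic over the tree's
PROVISIONAL weight numerals `wVH = stepScale²`, `wB2 = wM2 = stepScale³`, `wM1 = stepScale²` at `d + 1 = 4`); nothing here is a letter, a pin
RULING ((R45)/(P6) are the β-leads'), or a statement of Bałaban's papers; no `[cite:]`, no `def`, no `Prop` fact; instantiates no binder.
NOT D1, NOT `BetaPertH`, NOT continuum, NOT Clay.

WHERE THE LOCKS COME FROM (row owner's reading of an1-g28's toy-grade letters, journal l.11301 / l.11788, adjudication l.11557 / l.11963 — the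
letters themselves are an1's to land): with `γ_j := cVH·wVH j/(stepScale j·Lc⁴)` the contact coefficient of the first-order law at level `j`,
* (W-L-B) the border letter supplies `conjW₁`-coefficient `cB·wB2 (j+1)` (unit raw coefficient) against the target `−cVH·wVH (j+1)·γ_{j+1}`
  (`Vbd = (cVH·wVH) • vhSAt`, `X = γ·ctGen = −γ·X_an1`), and quadratic coefficient `cB·wB2 (j+1)` against `−stepScale (j+1)·Lc⁴·γ_{j+1}²`
  (`bhKAt^{fm} = −Lc⁴·linKerAt`): BOTH read `cB·wB2 (j+1) = −cVH²·wVH (j+1)²/(stepScale (j+1)·Lc⁴)` — `lockB_iff`: ⟺ `cB = −cVH²/Lc⁴` (every `j`);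
* (W-L-Λ) the mixed letter supplies `conjV (M1At) (X̂)`-coefficient `−γ^M_j/2`, `γ^M_j = 2·wM2 j/(cΛ·wM1 j)` (unit-weight `mixFF := mixFFAt`), against the
  target `γ_j`: `lockΛ_iff`: `−wM2 j/(cΛ·wM1 j) = cVH·wVH j/(stepScale j·Lc⁴)` ⟺ `cΛ·cVH = −Lc⁴` (every `j`, `cΛ ≠ 0`).
At the pin `cVH = −Lc⁸/2`: `cB = −Lc¹²/4`, `cΛ = 2/Lc⁴` (`pins_at_bcj`).  Provenance: β sub-cell, unit beta-an2 gen 18, 2026-08-20 (v1); no existing file touched.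
-/

open Literature.MathematicalPhysics.QuantumFieldTheory.Balaban1983to89.Beta
open BalabanStepJetsSucc (wE wVH)
open BalabanStepW2 (wV4 wB2 wM1 wM2)
open Summit.QuantumFields.BalabanUV.Beta.BorderedHessian (stepScale stepScale_ne_zero stepScale_pos)

noncomputable section

namespace Summit.QuantumFields.BalabanUV.Beta.SpineRooted

section Locks

variable {Lc : ℕ} [NeZero Lc]

omit [NeZero Lc] in
/-- [folklore] The provisional weights at `d + 1 = 4` as powers of the border scale `s_j = stepScale 3 Lc j = (Lc^j)^5`:
`wVH = s²`, `wB2 = s³`, `wM1 = s²`, `wM2 = s³`. -/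
theorem weights_eq_stepScale (j : ℕ) :
    wVH 3 Lc j = stepScale 3 Lc j ^ 2 ∧ wB2 3 Lc j = stepScale 3 Lc j ^ 3 ∧ wM1 3 Lc j = stepScale 3 Lc j ^ 2 ∧ wM2 3 Lc j = stepScale 3 Lc j ^ 3 := by
  refine ⟨?_, ?_, ?_, ?_⟩
  · simp only [BalabanStepJetsSucc.wVH, BorderedHessian.stepScale]; ring
  · simp only [BalabanStepW2.wB2, BorderedHessian.stepScale]; ring
  · simp only [BalabanStepW2.wM1, BorderedHessian.stepScale]; ring
  · simp only [BalabanStepW2.wM2, BorderedHessian.stepScale]; ring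

/-- [folklore] **(W-L-B) IS THE PIN `cB = −cVH²/Lc⁴`** (every level): `cB·wB2 (j+1) = −cVH²·wVH (j+1)²/(stepScale (j+1)·Lc⁴) ↔ cB = −cVH²/Lc⁴`. -/
theorem lockB_iff (cB cVH : ℝ) (j : ℕ) :
    cB * wB2 3 Lc (j + 1) = -(cVH ^ 2 * wVH 3 Lc (j + 1) ^ 2) / (stepScale 3 Lc (j + 1) * (Lc : ℝ) ^ 4) ↔ cB = -(cVH ^ 2) / (Lc : ℝ) ^ 4 := by
  obtain ⟨h1, h2, -, -⟩ := weights_eq_stepScale (Lc := Lc) (j + 1)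
  have hs : stepScale 3 Lc (j + 1) ≠ 0 := stepScale_ne_zero (j + 1)
  have hL : (Lc : ℝ) ^ 4 ≠ 0 := pow_ne_zero _ (by exact_mod_cast NeZero.ne Lc)
  rw [h1, h2, eq_div_iff (mul_ne_zero hs hL), eq_div_iff hL]
  set s := stepScale 3 Lc (j + 1) with hsdef
  constructor
  · intro h
    have h' : (cB * (Lc : ℝ) ^ 4 + cVH ^ 2) * s ^ 4 = 0 := by linear_combination h
    rcases mul_eq_zero.1 h' with h0 | h0
    · linear_combination h0
    · exact absurd h0 (pow_ne_zero 4 hs)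
  · intro h
    linear_combination s ^ 4 * h

/-- [folklore] **(W-L-Λ) IS THE PIN `cΛ·cVH = −Lc⁴`** (every level, `cΛ ≠ 0`): the `conjV`-coefficient `−γ^M_j/2 = −wM2 j/(cΛ·wM1 j)` of the mixed
letter at unit weight (`γ^M_j = 2·wM2 j/(cΛ·wM1 j)`) equals the first-order contact coefficient `γ_j = cVH·wVH j/(stepScale j·Lc⁴)` iff `cΛ·cVH = −Lc⁴`. -/
theorem lockΛ_iff (cΛ cVH : ℝ) (hcΛ : cΛ ≠ 0) (j : ℕ) :
    -(wM2 3 Lc j) / (cΛ * wM1 3 Lc j) = cVH * wVH 3 Lc j / (stepScale 3 Lc j * (Lc : ℝ) ^ 4) ↔ cΛ * cVH = -((Lc : ℝ) ^ 4) := by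
  obtain ⟨h1, -, h3, h4⟩ := weights_eq_stepScale (Lc := Lc) j
  have hs : stepScale 3 Lc j ≠ 0 := stepScale_ne_zero j
  have hL : (Lc : ℝ) ^ 4 ≠ 0 := pow_ne_zero _ (by exact_mod_cast NeZero.ne Lc)
  rw [h1, h3, h4, div_eq_div_iff (mul_ne_zero hcΛ (pow_ne_zero 2 hs)) (mul_ne_zero hs hL)]
  set s := stepScale 3 Lc j with hsdef
  constructor
  · intro h
    have h' : (cΛ * cVH + (Lc : ℝ) ^ 4) * s ^ 4 = 0 := by linear_combination -h
    rcases mul_eq_zero.1 h' with h0 | h0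
    · linear_combination h0
    · exact absurd h0 (pow_ne_zero 4 hs)
  · intro h
    linear_combination -(s ^ 4) * h

/-- [folklore] **THE PINS AT `cVH = −Lc⁸/2`**: `cB = −Lc¹²/4` and (for (W-L-Λ)) `cΛ = 2/Lc⁴`. -/
theorem pins_at_bcj :
    -((-((Lc : ℝ) ^ 8 / 2)) ^ 2) / (Lc : ℝ) ^ 4 = -((Lc : ℝ) ^ 12) / 4 ∧ (2 / (Lc : ℝ) ^ 4) * (-((Lc : ℝ) ^ 8 / 2)) = -((Lc : ℝ) ^ 4) := by
  have hL : (Lc : ℝ) ^ 4 ≠ 0 := pow_ne_zero _ (by exact_mod_cast NeZero.ne Lc)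
  constructor
  · rw [div_eq_div_iff hL (by norm_num : (4 : ℝ) ≠ 0)]
    ring
  · rw [div_mul_eq_mul_div, div_eq_iff hL]
    ring

end Locks

end Summit.QuantumFields.BalabanUV.Beta.SpineRooted

end
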